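import Mathlib
import Literature.Probability.RandomPlanarGeometry.ChordalCurveFamilyProofs
import Literature.Probability.RandomPlanarGeometry.CurveClassStopAtMeasurable
import Literature.Probability.RandomPlanarGeometry.CurveMonotoneReparam
import Literature.Probability.RandomPlanarGeometry.StopAtThickening
import HarnessLib

/-!
# Left-continuous level pasts admit an immediately entering representative

Crux `AxiomsOfLimit` (stmt-CriticalPhenomena-1370), line `registered`, stub `stub_markovOfLimit`: generic-level
no-grazing R2, piece (ii) (lead c4); registered sub-stub `stub_entryRepOfLeftContinuous`. Theorems only.

Fix a closed set `F` in a metric space `E`, a level `r > 0` and a curve `γ₀`; write `F_s := cthickening s F`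
and `h s := hitParam F_s γ₀` (antitone in `s`). The *level pasts* `s ↦ mk (γ₀.stopAt F_s)` are the classes of
the heads `γ₀ ∘ affineClamp 0 (h s)`. If they are left-continuous at `r` (as a map into the metric space
`CurveClass E`), then, unless `γ₀` is a constant curve, the class of `γ₀` has a representative `γ` which,
after its first hitting parameter `T` of `F_r` (if `T < 1`), is in the INTERIOR of `F_r` at parameters
arbitrarily close to `T` (`EntryRep.entryRep_of_tendsto`; planar class-level instance
`stub_entryRepOfLeftContinuous`, whose first hypothesis is the statement of the neighbouring registered stub
`stub_strictExtension`: equal head classes force a pause in between).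

Proof. Let `t₁ := h r ≤ t₂ := inf_{s < r} h s` (the left limit of `h` at `r`). Heads depend continuously on
the parameter (`EntryRep.continuous_head`), so the pasts tend to the class of the head up to `t₂`; by
uniqueness of limits this is the class of the head up to `t₁`, hence `γ₀` pauses on `[t₁, t₂]`.
* `t₁ = 1`: `γ₀` itself (nothing to prove).
* `t₂ = 1`, `t₁ = 0`: `γ₀` is constant.
* `t₂ = 1`, `0 < t₁ < 1`: the head `γ₀ ∘ affineClamp 0 t₁` represents the class (the head up to `t₂ = 1` is
  `γ₀`) and does not meet `F_r` before time `1`.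
* `t₂ < 1`: collapse the pause (`EntryRep.exists_collapsePause`: `γ₀` up to `t₁`, then `γ₀|[t₂, 1]` affinely;
  same class by `Curve.reparamDist_eq_zero_of_monotone'`). The collapsed curve `γ` first meets `F_r` at `t₁`,
  and for levels `s ↑ r` the hitting points `γ₀ (h s) ∈ F_s ⊆ interior F_r`, `h s ↓ t₂`, are values of `γ` at
  parameters `↓ t₁`; an open-set argument makes the parameter strictly larger than `t₁`.

Sources: M. Aizenman, A. Burchard, Duke Math. J. 99 (1999) §2.1 (the curve space); G. F. Lawler, O. Schramm,
W. Werner, Acta Math. 187 (2001) §2 (stopping at closed sets). The statements themselves are folklore.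
All [folklore].
-/

noncomputable section

open Filter Topology Set Metric
open scoped unitInterval

namespace Summit.CriticalPhenomena.SAWScalingLimit.Theorems.AxiomsOfLimitMarkov

open Literature.Probability.RandomPlanarGeometry

section Metric

variable {E : Type*} [MetricSpace E]

/-- Heads `γ ∘ affineClamp 0 T` of a fixed curve depend continuously on the parameter `T ∈ ℝ` for the
reparametrisation distance (uniform continuity of `γ`, `Curve.exists_dist_comp_affineClamp_le`). [folklore] -/
theorem EntryRep.continuous_head (γ : Curve E) :
    Continuous fun T : ℝ => (⟨γ.toContinuousMap.comp (Curve.affineClamp 0 T)⟩ : Curve E) := by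
  refine Metric.continuous_iff.2 fun T ε hε => ?_
  obtain ⟨δ, hδ, hmod⟩ := Curve.exists_dist_comp_affineClamp_le γ (half_pos hε)
  refine ⟨δ, hδ, fun T' hT' => ?_⟩
  refine (hmod 0 T' 0 T (by rw [sub_self, abs_zero]; exact hδ.le) ?_).trans_lt (half_lt_self hε)
  rw [Real.dist_eq] at hT'
  exact hT'.le

/-- A curve which is in an open set `U` at a parameter `v < M ≤ 1` is in `U` at some parameter of the open
interval `(v, M)`. [folklore] -/
theorem EntryRep.exists_param_gt (γ : Curve E) {U : Set E} (hU : IsOpen U) {v : I} (hv : γ v ∈ U)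
    {M : ℝ} (hvM : (v : ℝ) < M) (hM1 : M ≤ 1) :
    ∃ t : I, (v : ℝ) < t ∧ (t : ℝ) < M ∧ γ t ∈ U := by
  obtain ⟨δ, hδ, hball⟩ := Metric.isOpen_iff.1 (hU.preimage γ.continuous) v hv
  obtain ⟨m, hm0, hmδ, hmM⟩ : ∃ m : ℝ, 0 < m ∧ m < δ ∧ (v : ℝ) + m < M :=
    ⟨min (δ / 2) ((M - v) / 2), lt_min (half_pos hδ) (half_pos (sub_pos.2 hvM)),
      (min_le_left _ _).trans_lt (half_lt_self hδ),
      by linarith [min_le_right (δ / 2) ((M - v) / 2)]⟩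
  have htI : (v : ℝ) + m ∈ Icc (0 : ℝ) 1 := ⟨v.2.1.trans (le_add_of_nonneg_right hm0.le), by linarith⟩
  refine ⟨⟨_, htI⟩, lt_add_of_pos_right _ hm0, hmM, ?_⟩
  have hmem : (⟨_, htI⟩ : I) ∈ ball v δ := by
    rw [Metric.mem_ball, Subtype.dist_eq, Real.dist_eq]
    show |(v : ℝ) + m - v| < δ
    rw [add_sub_cancel_left, abs_of_pos hm0]
    exact hmδ
  exact hball hmem

/-- **Pause collapse.** If `γ₀` is constant on `[A, B]` (`B < 1`), the curve `γ` which runs through `γ₀` up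
to `A` and then through `γ₀|[B, 1]`, affinely reparametrised by `[A, 1]`, is at reparametrisation distance
`0` from `γ₀` (`γ₀ = γ ∘ ψ` for the monotone continuous surjection `ψ` of `[0, 1]` squeezing `[A, B]` to `A`;
`Curve.reparamDist_eq_zero_of_monotone'`). Recorded with the two evaluation formulas. [folklore] -/
theorem EntryRep.exists_collapsePause (γ₀ : Curve E) (A B : I) (hAB : A ≤ B) (hB1 : (B : ℝ) < 1)
    (hconst : ∀ u : I, A ≤ u → u ≤ B → γ₀ u = γ₀ B) :
    ∃ γ : Curve E, dist γ₀ γ = 0 ∧ (∀ v : I, (v : ℝ) ≤ A → γ v = γ₀ v) ∧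
      ∀ u : I, (B : ℝ) ≤ u →
        γ (projIcc 0 1 zero_le_one ((A : ℝ) + ((u : ℝ) - B) * ((1 - A) / (1 - B)))) = γ₀ u := by
  have hA0 : (0 : ℝ) ≤ A := A.2.1
  have hAB' : (A : ℝ) ≤ B := hAB
  have hA1 : (A : ℝ) < 1 := hAB'.trans_lt hB1
  have h1B : (0 : ℝ) < 1 - B := sub_pos.2 hB1
  set k : ℝ := (1 - A) / (1 - B) with hk
  have hk1 : 1 ≤ k := by rw [hk, one_le_div h1B]; linarith
  have hk0 : 0 < k := one_pos.trans_le hk1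
  have hkk : (1 - (B : ℝ)) * k = 1 - A := by rw [hk]; field_simp
  -- the collapsed curve
  have hcont : Continuous fun v : I =>
      if (v : ℝ) ≤ A then γ₀ v else γ₀ (projIcc 0 1 zero_le_one ((B : ℝ) + ((v : ℝ) - A) / k)) := by
    refine Continuous.if_le γ₀.continuous ?_ continuous_subtype_val continuous_const ?_
    · exact γ₀.continuous.comp (continuous_projIcc.comp (by fun_prop))
    · intro v hv
      have hvA : v = A := Subtype.ext hv
      rw [hvA, sub_self, zero_div, add_zero, projIcc_val]
      exact hconst A le_rfl hAB
  let γ : Curve E := ⟨⟨_, hcont⟩⟩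
  have hγapply : ∀ v : I, γ v =
      if (v : ℝ) ≤ A then γ₀ v else γ₀ (projIcc 0 1 zero_le_one ((B : ℝ) + ((v : ℝ) - A) / k)) :=
    fun v => rfl
  have hle : ∀ v : I, (v : ℝ) ≤ A → γ v = γ₀ v := fun v hv => by rw [hγapply, if_pos hv]
  have hge : ∀ u : I, (B : ℝ) ≤ u →
      γ (projIcc 0 1 zero_le_one ((A : ℝ) + ((u : ℝ) - B) * k)) = γ₀ u := by
    intro u hu
    have hw0 : (0 : ℝ) ≤ (u : ℝ) - B := sub_nonneg.2 hu
    have hAw : (A : ℝ) ≤ A + ((u : ℝ) - B) * k := le_add_of_nonneg_right (mul_nonneg hw0 hk0.le)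
    have hw1 : (A : ℝ) + ((u : ℝ) - B) * k ≤ 1 := by
      have : ((u : ℝ) - B) * k ≤ (1 - B) * k :=
        mul_le_mul_of_nonneg_right (by linarith [u.2.2]) hk0.le
      linarith
    rcases hw0.eq_or_lt with heq | hpos
    · -- `u = B`: the parameter is `A`
      have huB : u = B := Subtype.ext (by linarith)
      rw [huB, sub_self, zero_mul, add_zero, projIcc_val, hle A le_rfl]
      exact hconst A le_rfl hAB
    · have hAw' : (A : ℝ) < A + ((u : ℝ) - B) * k := lt_add_of_pos_right _ (mul_pos hpos hk0)
      have hτ : (B : ℝ) + ((A : ℝ) + ((u : ℝ) - B) * k - A) / k = u := by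
        field_simp
        ring
      rw [hγapply, projIcc_of_mem _ ⟨hA0.trans hAw, hw1⟩, if_neg (not_le.2 hAw')]
      congr 1
      rw [hτ, projIcc_val]
  refine ⟨γ, ?_, hle, hge⟩
  -- `γ₀ = γ ∘ ψ`, `ψ = max (min · A) (A + (· - B) k)` monotone, continuous, onto `[0, 1]`
  rw [Curve.dist_def]
  refine Curve.reparamDist_eq_zero_of_monotone' (m := 1) zero_le_one
    (V := fun y => γ (projIcc 0 1 zero_le_one y))
    (h₁ := fun x => max (min x A) ((A : ℝ) + (x - B) * k)) (h₂ := fun x => x)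
    ?_ ?_ ?_ ?_ ?_ ?_ ?_ ?_ ?_ ?_ ?_
  · exact (γ.continuous.comp continuous_projIcc).continuousOn
  · fun_prop
  · exact continuous_id
  · exact fun x y hxy => max_le_max (min_le_min hxy le_rfl)
      (add_le_add le_rfl (mul_le_mul_of_nonneg_right (sub_le_sub_right hxy _) hk0.le))
  · exact fun x y hxy => hxy
  · show max (min (0 : ℝ) A) ((A : ℝ) + (0 - B) * k) = 0
    rw [min_eq_left hA0, max_eq_left]
    nlinarith [hk1, hAB', hA0, B.2.1]
  · rfl
  · show max (min (1 : ℝ) A) ((A : ℝ) + (1 - B) * k) = 1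
    rw [hkk, add_sub_cancel, min_eq_right hA1.le, max_eq_right hA1.le]
  · rfl
  · intro x
    show γ₀ x = γ (projIcc 0 1 zero_le_one (max (min (x : ℝ) A) ((A : ℝ) + ((x : ℝ) - B) * k)))
    rcases le_or_gt (x : ℝ) A with hxA | hAx
    · have e : max (min (x : ℝ) A) ((A : ℝ) + ((x : ℝ) - B) * k) = x := by
        rw [min_eq_left hxA, max_eq_left]
        nlinarith [hk1, hxA, hAB']
      rw [e, projIcc_val, hle x hxA]
    · rcases le_or_gt (x : ℝ) B with hxB | hBx
      · have e : max (min (x : ℝ) A) ((A : ℝ) + ((x : ℝ) - B) * k) = A := by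
          rw [min_eq_right hAx.le, max_eq_left]
          nlinarith [hk0, hxB]
        rw [e, projIcc_val, hle A le_rfl, hconst x hAx.le hxB]
        exact (hconst A le_rfl hAB).symm
      · have e : max (min (x : ℝ) A) ((A : ℝ) + ((x : ℝ) - B) * k) = (A : ℝ) + ((x : ℝ) - B) * k := by
          rw [min_eq_right hAx.le, max_eq_right]
          exact le_add_of_nonneg_right (mul_nonneg (by linarith) hk0.le)
        rw [e, hge x hBx.le]
  · intro x
    show γ x = γ (projIcc 0 1 zero_le_one x)
    rw [projIcc_val]

/-- **Immediate entry from left-continuity of the level pasts** (curve level, `E` a metric space). Assume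
that equal head classes force a pause (`hSE`, the statement of the registered stub `stub_strictExtension`
at `E`). If the classes of the heads of `γ₀` up to its first hitting of `cthickening s F` tend, as `s ↑ r`,
to the class of the head up to the first hitting of `cthickening r F` (`F` closed, `r > 0`), then either
`γ₀` is a constant curve, or its class has a representative which, right after its first hitting parameter
of `cthickening r F` (if `< 1`), visits the interior of `cthickening r F`. See the module docstring for the
proof. [folklore] -/
theorem EntryRep.entryRep_of_tendsto
    (hSE : ∀ (γ : Curve E) (t₁ t₂ : I), t₁ < t₂ →
      dist (⟨γ.toContinuousMap.comp (Curve.affineClamp 0 t₁)⟩ : Curve E)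
        ⟨γ.toContinuousMap.comp (Curve.affineClamp 0 t₂)⟩ = 0 →
      ∀ u : I, t₁ ≤ u → u ≤ t₂ → γ u = γ t₂)
    {F : Set E} {r : ℝ} (hr : 0 < r) (γ₀ : Curve E)
    (hlc : Tendsto (fun s : ℝ => CurveClass.mk (γ₀.stopAt (cthickening s F))) (𝓝[<] r)
      (𝓝 (CurveClass.mk (γ₀.stopAt (cthickening r F))))) :
    (∃ x : E, γ₀ = Curve.const x) ∨ ∃ γ : Curve E, CurveClass.mk γ = CurveClass.mk γ₀ ∧
      (γ.hitParam (cthickening r F) < 1 → ∀ ε : ℝ, 0 < ε → ∃ t : I,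
        γ.hitParam (cthickening r F) < (t : ℝ) ∧ (t : ℝ) < γ.hitParam (cthickening r F) + ε ∧
          γ t ∈ interior (cthickening r F)) := by
  -- the hitting levels `h s`, antitone in `s`, with values in `[0, 1]`
  set h : ℝ → ℝ := fun s => γ₀.hitParam (cthickening s F) with hh
  have hanti : Antitone h := fun s s' hss' => Curve.hitParam_mono (cthickening_mono hss' F) γ₀
  have hI : ∀ s, h s ∈ Icc (0 : ℝ) 1 := fun s => γ₀.hitParam_mem_Icc _
  -- the left limit `t₂` of `h` at `r`
  set t₂ : ℝ := sInf (h '' Iio r) with ht₂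
  have hne : (h '' Iio r).Nonempty := ⟨h (r - 1), mem_image_of_mem h (sub_one_lt r)⟩
  have hbdd : BddBelow (h '' Iio r) := ⟨0, by rintro _ ⟨s, -, rfl⟩; exact (hI s).1⟩
  have hlim : Tendsto h (𝓝[<] r) (𝓝 t₂) := hanti.tendsto_nhdsLT r
  have ht₂le : ∀ s, s < r → t₂ ≤ h s := fun s hs => csInf_le hbdd (mem_image_of_mem h hs)
  have ht₁t₂ : h r ≤ t₂ := le_csInf hne (by rintro _ ⟨s, hs, rfl⟩; exact hanti (le_of_lt hs))
  have ht₂1 : t₂ ≤ 1 := (ht₂le (r / 2) (half_lt_self hr)).trans (hI _).2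
  have ht₂0 : 0 ≤ t₂ := (hI r).1.trans ht₁t₂
  have happrox : ∀ m, t₂ < m → ∃ s, 0 < s ∧ s < r ∧ h s < m := by
    intro m hm
    obtain ⟨_, ⟨s, hs, rfl⟩, hsm⟩ := exists_lt_of_csInf_lt hne hm
    exact ⟨max s (r / 2), lt_max_of_lt_right (half_pos hr), max_lt hs (half_lt_self hr),
      (hanti (le_max_left s (r / 2))).trans_lt hsm⟩
  -- STEP 1: the left limit of the pasts is the head up to `t₂`; uniqueness of limits; the pause
  obtain ⟨T₁, hT₁⟩ : ∃ T₁ : I, (T₁ : ℝ) = h r := ⟨⟨h r, hI r⟩, rfl⟩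
  obtain ⟨T₂, hT₂⟩ : ∃ T₂ : I, (T₂ : ℝ) = t₂ := ⟨⟨t₂, ht₂0, ht₂1⟩, rfl⟩
  have hT₁T₂ : T₁ ≤ T₂ := by
    show (T₁ : ℝ) ≤ T₂
    rw [hT₁, hT₂]
    exact ht₁t₂
  have hlc' : Tendsto
      (fun s => CurveClass.mk (⟨γ₀.toContinuousMap.comp (Curve.affineClamp 0 (h s))⟩ : Curve E))
      (𝓝[<] r) (𝓝 (CurveClass.mk ⟨γ₀.toContinuousMap.comp (Curve.affineClamp 0 T₁)⟩)) := by
    rw [← Curve.stopAt_eq_of_coe_eq (F := cthickening r F) hT₁]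
    exact hlc
  have hlim' : Tendsto
      (fun s => CurveClass.mk (⟨γ₀.toContinuousMap.comp (Curve.affineClamp 0 (h s))⟩ : Curve E))
      (𝓝[<] r) (𝓝 (CurveClass.mk ⟨γ₀.toContinuousMap.comp (Curve.affineClamp 0 T₂)⟩)) := by
    rw [hT₂]
    exact ((CurveClass.continuous_mk.comp (EntryRep.continuous_head γ₀)).tendsto t₂).comp hlim
  have hdist : dist (⟨γ₀.toContinuousMap.comp (Curve.affineClamp 0 T₁)⟩ : Curve E)
      ⟨γ₀.toContinuousMap.comp (Curve.affineClamp 0 T₂)⟩ = 0 :=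
    CurveClass.mk_eq_mk_iff_dist_eq_zero.1 (tendsto_nhds_unique hlc' hlim')
  have hconst : ∀ u : I, T₁ ≤ u → u ≤ T₂ → γ₀ u = γ₀ T₂ := by
    intro u hu₁ hu₂
    rcases hT₁T₂.lt_or_eq with hlt | heq
    · exact hSE γ₀ T₁ T₂ hlt hdist u hu₁ hu₂
    · rw [heq] at hu₁
      rw [le_antisymm hu₂ hu₁]
  -- STEP 2: cases
  rcases eq_or_lt_of_le ht₂1 with ht₂eq | ht₂lt
  · -- the left limit is `1`: `γ₀` pauses on `[T₁, 1]`
    rcases eq_or_lt_of_le (hI r).2 with ht₁eq | ht₁lt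
    · -- (a) `h r = 1`: `γ₀` itself, the entry clause is vacuous
      exact Or.inr ⟨γ₀, rfl, fun hlt => absurd ht₁eq (ne_of_lt hlt)⟩
    rcases eq_or_lt_of_le (hI r).1 with ht₁0 | ht₁pos
    · -- (c1) `h r = 0`: `γ₀` is constant
      refine Or.inl ⟨γ₀ T₂, Curve.ext (ContinuousMap.ext fun u => hconst u ?_ ?_)⟩
      · show (T₁ : ℝ) ≤ u
        rw [hT₁, ← ht₁0]
        exact u.2.1
      · show (u : ℝ) ≤ T₂
        rw [hT₂, ht₂eq]
        exact u.2.2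
    · -- (c2) `0 < h r < 1`: the head up to `T₁` represents the class and never meets `F_r` before `1`
      refine Or.inr ⟨⟨γ₀.toContinuousMap.comp (Curve.affineClamp 0 T₁)⟩, ?_, fun hlt => ?_⟩
      · have hhead : (⟨γ₀.toContinuousMap.comp (Curve.affineClamp 0 T₂)⟩ : Curve E) = γ₀ := by
          refine Curve.ext (ContinuousMap.ext fun u => ?_)
          show γ₀ (Curve.affineClamp 0 T₂ u) = γ₀ u
          rw [Curve.affineClamp_apply, hT₂, ht₂eq, zero_add, one_mul, projIcc_val]
        calc CurveClass.mk (⟨γ₀.toContinuousMap.comp (Curve.affineClamp 0 T₁)⟩ : Curve E)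
            = CurveClass.mk ⟨γ₀.toContinuousMap.comp (Curve.affineClamp 0 T₂)⟩ :=
              CurveClass.mk_eq_mk_iff_dist_eq_zero.2 hdist
          _ = CurveClass.mk γ₀ := by rw [hhead]
      · exfalso
        refine absurd (le_antisymm (Curve.hitParam_mem_Icc _ _).2 ?_) (ne_of_lt hlt)
        refine le_of_forall_lt_imp_le_of_dense fun η hη => ?_
        refine Curve.le_hitParam_of_forall_notMem hη.le fun v hv => ?_
        show γ₀ (Curve.affineClamp 0 T₁ v) ∉ cthickening r F
        refine Curve.notMem_of_lt_hitParam ?_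
        rw [Curve.affineClamp_apply, zero_add, hT₁, projIcc_of_mem _ (unitInterval.mul_mem (hI r) v.2)]
        exact mul_lt_of_lt_one_right ht₁pos (hv.trans_lt hη)
  · -- `t₂ < 1`: collapse the pause `[T₁, T₂]`
    have hT₂1 : (T₂ : ℝ) < 1 := by rw [hT₂]; exact ht₂lt
    obtain ⟨γ, hγ0, hγle, hγge⟩ := EntryRep.exists_collapsePause γ₀ T₁ T₂ hT₁T₂ hT₂1 hconst
    rw [hT₁] at hγle
    rw [hT₁, hT₂] at hγge
    have ht₁lt : h r < 1 := ht₁t₂.trans_lt ht₂lt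
    refine Or.inr ⟨γ, CurveClass.mk_eq_mk_iff_dist_eq_zero.2 (by rw [dist_comm]; exact hγ0),
      fun _ ε hε => ?_⟩
    -- `γ₀` meets `F_r`, first at `T₁`; so does `γ`, which agrees with `γ₀` up to `T₁`
    have hT₁mem : γ₀ T₁ ∈ cthickening r F := by
      have hhit : ∃ t, γ₀ t ∈ cthickening r F :=
        not_forall_not.1 fun hno => absurd (Curve.hitParam_eq_one_of_forall_notMem hno) (ne_of_lt ht₁lt)
      have hmem := Curve.apply_hitParam_mem isClosed_cthickening hhit
      rwa [show (⟨γ₀.hitParam (cthickening r F), γ₀.hitParam_mem_Icc _⟩ : I) = T₁ from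
        Subtype.ext hT₁.symm] at hmem
    have hT : γ.hitParam (cthickening r F) = h r := by
      refine le_antisymm ?_ (le_of_forall_lt_imp_le_of_dense fun η hη => ?_)
      · rw [← hT₁]
        refine Curve.hitParam_le ?_
        rw [hγle T₁ hT₁.le]
        exact hT₁mem
      · refine Curve.le_hitParam_of_forall_notMem (hη.le.trans (hI r).2) fun v hv => ?_
        rw [hγle v (hv.trans hη.le)]
        exact Curve.notMem_of_lt_hitParam (hv.trans_lt hη)
    rw [hT]
    -- slope of the parameter change from `γ₀` after `t₂` to `γ` after `h r`
    have hk0 : 0 < (1 - h r) / (1 - t₂) := div_pos (by linarith) (by linarith)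
    set k : ℝ := (1 - h r) / (1 - t₂) with hk
    have hkk : (1 - t₂) * k = 1 - h r := by rw [hk]; field_simp
    -- a positive level `s < r` whose hitting parameter is close to `t₂`
    obtain ⟨s, -, hsr, hsm⟩ := happrox (min 1 (t₂ + ε / k))
      (lt_min ht₂lt (lt_add_of_pos_right _ (div_pos hε hk0)))
    have hs1 : h s < 1 := hsm.trans_le (min_le_left _ _)
    have hsε : h s < t₂ + ε / k := hsm.trans_le (min_le_right _ _)
    have ht₂s : t₂ ≤ h s := ht₂le s hsr
    -- `γ₀` enters `F_s ⊆ interior F_r` at the parameter `h s`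
    have hmem : γ₀ ⟨h s, hI s⟩ ∈ interior (cthickening r F) := by
      have hhit : ∃ t, γ₀ t ∈ cthickening s F :=
        not_forall_not.1 fun hno => absurd (Curve.hitParam_eq_one_of_forall_notMem hno) (ne_of_lt hs1)
      exact ((cthickening_subset_thickening' hr hsr F).trans
        (thickening_subset_interior_cthickening r F))
          (Curve.apply_hitParam_mem isClosed_cthickening hhit)
    -- the corresponding parameter `h r + (h s - t₂) k ∈ [h r, 1)` of `γ`
    have hv₀ge : h r ≤ h r + (h s - t₂) * k :=
      le_add_of_nonneg_right (mul_nonneg (sub_nonneg.2 ht₂s) hk0.le)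
    have hv₀lt1 : h r + (h s - t₂) * k < 1 := by
      have : (h s - t₂) * k < (1 - t₂) * k := mul_lt_mul_of_pos_right (by linarith) hk0
      linarith
    have hv₀ltε : h r + (h s - t₂) * k < h r + ε := by
      have : (h s - t₂) * k < ε / k * k := mul_lt_mul_of_pos_right (by linarith) hk0
      rw [div_mul_cancel₀ ε hk0.ne'] at this
      linarith
    have hv₀val : ((projIcc (0 : ℝ) 1 zero_le_one (h r + (h s - t₂) * k) : I) : ℝ) =
        h r + (h s - t₂) * k := by
      rw [projIcc_of_mem _ ⟨(hI r).1.trans hv₀ge, hv₀lt1.le⟩]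
    have hγv₀ : γ (projIcc 0 1 zero_le_one (h r + (h s - t₂) * k)) = γ₀ ⟨h s, hI s⟩ :=
      hγge ⟨h s, hI s⟩ ht₂s
    have hγv₀' : γ (projIcc 0 1 zero_le_one (h r + (h s - t₂) * k)) ∈ interior (cthickening r F) := by
      rw [hγv₀]
      exact hmem
    obtain ⟨t, ht1, ht2, ht3⟩ := EntryRep.exists_param_gt γ isOpen_interior hγv₀'
      (M := min 1 (h r + ε)) (by rw [hv₀val]; exact lt_min hv₀lt1 hv₀ltε) (min_le_left _ _)
    rw [hv₀val] at ht1
    exact ⟨t, by linarith, ht2.trans_le (min_le_right _ _), ht3⟩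

end Metric

/-- **Registered sub-goal `stub_entryRepOfLeftContinuous`** (crux stmt-CriticalPhenomena-1370, generic-level no-grazing
R2, piece (ii)): assuming that equal head classes force a pause (the neighbouring stub `stub_strictExtension`), a planar
curve class whose level pasts `s ↦ c.stopAt (cthickening s F)` are left-continuous at the level `r > 0` (`F` closed) is
either the class of a constant curve or has a representative entering the interior of `cthickening r F` immediately
after its first hitting parameter (`EntryRep.entryRep_of_tendsto` for the chosen representative `c.out`). [folklore] -/
theorem stub_entryRepOfLeftContinuous : (∀ (γ : Literature.Probability.RandomPlanarGeometry.Curve ℂ) (t₁ t₂ : unitInterval), t₁ < t₂ → dist (⟨γ.toContinuousMap.comp (Literature.Probability.RandomPlanarGeometry.Curve.affineClamp 0 t₁)⟩ : Literature.Probability.RandomPlanarGeometry.Curve ℂ) ⟨γ.toContinuousMap.comp (Literature.Probability.RandomPlanarGeometry.Curve.affineClamp 0 t₂)⟩ = 0 → ∀ u : unitInterval, t₁ ≤ u → u ≤ t₂ → γ u = γ t₂) → ∀ (F : Set ℂ), IsClosed F → ∀ (r : ℝ), 0 < r → ∀ c : Literature.Probability.RandomPlanarGeometry.CurveClass ℂ,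 Filter.Tendsto (fun s : ℝ => c.stopAt (Metric.cthickening s F)) (nhdsWithin r (Set.Iio r)) (nhds (c.stopAt (Metric.cthickening r F))) → (∃ x : ℂ, c = Literature.Probability.RandomPlanarGeometry.CurveClass.mk (Literature.Probability.RandomPlanarGeometry.Curve.const x)) ∨ ∃ γ : Literature.Probability.RandomPlanarGeometry.Curve ℂ, Literature.Probability.RandomPlanarGeometry.CurveClass.mk γ = c ∧ (γ.hitParam (Metric.cthickening r F) < 1 → ∀ ε : ℝ, 0 < ε → ∃ t : unitInterval, γ.hitParam (Metric.cthickening r F) < (t : ℝ) ∧ (t : ℝ) < γ.hitParam (Metric.cthickening r F) + ε ∧ γ t ∈ interior (Metric.cthickening r F)) := by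
  intro hSE F _hF r hr c hlc
  rcases EntryRep.entryRep_of_tendsto hSE hr c.out hlc with ⟨x, hx⟩ | ⟨γ, hγ, hP⟩
  · exact Or.inl ⟨x, by rw [← CurveClass.mk_out c, hx]⟩
  · exact Or.inr ⟨γ, hγ.trans (CurveClass.mk_out c), hP⟩

end Summit.CriticalPhenomena.SAWScalingLimit.Theorems.AxiomsOfLimitMarkov

end
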